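import Mathlib
import HarnessLib
import Summits.MatrixMultiplication.MatrixMultiplication.Theorems.FarEdgeDescentAllArities
import Summits.MatrixMultiplication.MatrixMultiplication.Theorems.FarEdgeDescentAnchorTax
import Summits.MatrixMultiplication.MatrixMultiplication.Theorems.FarEdgeDescentEndpointCriterion

/-!
# Far-edge descent — the chord split of the region criterion (kernel XLVII, lens-2 g63)

The region criterion `RegionCriterion β z ε Vmin κ_S` (kernel XLII, `FarEdgeDescentNarrownessPotential`)
is a pair inequality `A·x^{κ_S} + B·(1−x)^{κ_S} ≤ R` for all `x ∈ [0,1]`, with `A, B, R` polynomial in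
the share/narrowness data of the two factors; its supremum in `x` is the Hölder mean
`(A^q + B^q)^{1/q}`, `q = 1/(1−κ_S) = log 2/log(3/2)` — the only transcendental ingredient, and the
reason the strict regime was so far certified by tangent menus on `x`-partitions (thousands of cells).

This file DISCHARGES THE TRANSCENDENTAL PART ONCE, uniformly in `β`: the convex function
`t ↦ (1 + t^q)^{1/q}` on `[0,1]` lies below its two chords through the nodes `t = 0, 1/2, 1`, whose values
`1`, `≤ 59/50`, `3/2` are certified here from `17/41 ≤ κ_S ≤ 22/53` (`one_two_bound`:
`x^{κ_S} + 2(1−x)^{κ_S} ≤ 59/25`, by the two-term Hölder inequality of `FarEdgeDescentAnchorTax` and two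
integer inequalities).  Consequently (`pair_le_of_chords`) the pair inequality follows from FOUR LINEAR
inequalities in `(A, B, R)`, and — with the β-free DEFECT IDENTITY `R = A + B − D`,
`D = λλ'(z α α' + w(α + α' − 1 − ε))`, `α = ε+1−V`, `w = 1 − z(1+ε)` (`defect_identity_gen`) — the region
criterion at ANY dial follows from two POLYNOMIAL conditions on the pinned region
(`regionCriterion_of_chordConditions`):

  (I)  `D ≤ (16/25)·min(A, B)`,        (II) `D ≤ (9/25)·min(A, B) + (7/50)·max(A, B)`.

What this buys (lens «special vs generic», model level): (i) kernel XLVI's endpoint theorem is the case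
where (I) and (II) follow from `2D ≤ min(A,B)` (`chordConditions_two_floorZero`; with the
reduction, a second proof of `regionCriterion_two_floorZero`); (ii) the OPEN CORNER `(199/100, 2)` of the dial is reduced to (I) ∧ (II)
for a β-dependent regulariser family (`capXLD_corner_of_chordConditions`) — a purely semialgebraic target
with NO exponentials, where (memo NODE-g63 §3, numerics only) (I) holds with a uniform 14 % margin and
(II) is binding exactly on the product-floor exclusion boundary `V_P = Vfloor` near the fixed-point pair,
with renormalised margin `0.72 v + 0.28 v' − 1/2 ≥ 1.28·(Vfloor/(2−β)) − 1/2 > 0` (needs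
`Vfloor/(2−β) > 0.39`; the tree's floors give `0.47…0.497`).  No `sorry`, no new definitions.
-/

noncomputable section

set_option linter.dupNamespace false
set_option linter.style.longLine false

namespace Summit.MatrixMultiplication.MatrixMultiplication.Theorems.FarEdgeDescentChordSplit

open Finset
open Summit.MatrixMultiplication.MatrixMultiplication.Theorems.FarEdgeDescentFloorDial
open Summit.MatrixMultiplication.MatrixMultiplication.Theorems.FarEdgeDescentFloorDial.Sched
open Summit.MatrixMultiplication.MatrixMultiplication.Theorems.FarEdgeDescentNarrownessPotential
open Summit.MatrixMultiplication.MatrixMultiplication.Theorems.FarEdgeDescentFloorNarrowness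
open Summit.MatrixMultiplication.MatrixMultiplication.Theorems.FarEdgeDescentTreeCapTools
open Summit.MatrixMultiplication.MatrixMultiplication.Theorems.FarEdgeDescentAllArities
open Summit.MatrixMultiplication.MatrixMultiplication.Theorems.FarEdgeDescentDialDegeneration
open Summit.MatrixMultiplication.MatrixMultiplication.Theorems.FarEdgeDescentEndpointCriterion

/-! ## 1. The certified node value at `t = 1/2`: `x^{κ_S} + 2(1−x)^{κ_S} ≤ 59/25` -/

/-- `2^{53/31} ≤ 32713/10000` (from `2^53 ≤ (32713/10000)^31`). -/
theorem two_rpow_le : (2 : ℝ) ^ ((53 : ℝ) / 31) ≤ 32713 / 10000 := by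
  have h2 : ((2 : ℝ) ^ ((53 : ℝ) / 31)) ^ (31 : ℕ) = (2 : ℝ) ^ (53 : ℕ) := by
    rw [← Real.rpow_natCast, ← Real.rpow_mul (by norm_num : (0:ℝ) ≤ 2)]
    norm_num
  have h3 : 0 ≤ (2 : ℝ) ^ ((53 : ℝ) / 31) := Real.rpow_nonneg (by norm_num) _
  by_contra hlt
  push Not at hlt
  have : (32713 / 10000 : ℝ) ^ (31 : ℕ) < ((2 : ℝ) ^ ((53 : ℝ) / 31)) ^ (31 : ℕ) :=
    pow_lt_pow_left₀ hlt (by norm_num) (by norm_num)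
  rw [h2] at this
  norm_num at this

/-- `(42713/10000)^{24/41} ≤ 59/25` (from `(42713/10000)^24 ≤ (59/25)^41`). -/
theorem rpow_24_41_le : (42713 / 10000 : ℝ) ^ ((24 : ℝ) / 41) ≤ 59 / 25 := by
  have h2 : ((42713 / 10000 : ℝ) ^ ((24 : ℝ) / 41)) ^ (41 : ℕ) = (42713 / 10000 : ℝ) ^ (24 : ℕ) := by
    rw [← Real.rpow_natCast, ← Real.rpow_mul (by norm_num : (0:ℝ) ≤ 42713 / 10000)]
    norm_num
  have h3 : 0 ≤ (42713 / 10000 : ℝ) ^ ((24 : ℝ) / 41) := Real.rpow_nonneg (by norm_num) _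
  by_contra hlt
  push Not at hlt
  have : (59 / 25 : ℝ) ^ (41 : ℕ) < ((42713 / 10000 : ℝ) ^ ((24 : ℝ) / 41)) ^ (41 : ℕ) :=
    pow_lt_pow_left₀ hlt (by norm_num) (by norm_num)
  rw [h2] at this
  norm_num at this

/-- **The node value.**  `x^{κ_S} + 2·(1−x)^{κ_S} ≤ 59/25` on `[0,1]` (true supremum `(1+2^q)^{1/q} =
2.3378`; two-term Hölder with weights `1, 2^q`, then `q ≤ 53/31`, `1 − κ_S ≤ 24/41`). -/
theorem one_two_bound {x : ℝ} (hx0 : 0 ≤ x) (hx1 : x ≤ 1) :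
    x ^ (Real.log (4 / 3) / Real.log 2) + 2 * (1 - x) ^ (Real.log (4 / 3) / Real.log 2) ≤ 59 / 25 := by
  set κ := Real.log (4 / 3) / Real.log 2 with hκ
  have hk0 : 0 < κ := kappaS_pos
  have hk1 : κ < 1 := kappaS_lt_one
  have hk22 : κ ≤ 22 / 53 := kappaS_le
  have hk17 : 17 / 41 ≤ κ := kappaS_ge
  have h1κ : 0 < 1 - κ := by linarith
  -- the Hölder weight b = 2^{1/(1−κ)}, b^{1−κ} = 2
  set b := (2 : ℝ) ^ (1 / (1 - κ)) with hb
  have hb0 : 0 ≤ b := Real.rpow_nonneg (by norm_num) _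
  have hbpow : b ^ (1 - κ) = 2 := by
    rw [hb, ← Real.rpow_mul (by norm_num : (0:ℝ) ≤ 2)]
    have : 1 / (1 - κ) * (1 - κ) = 1 := by field_simp
    rw [this, Real.rpow_one]
  have hH := FarEdgeDescentAnchorTax.holder_two hk0 hk1 (by norm_num : (0:ℝ) ≤ 1) hb0 hx0
    (by linarith : (0:ℝ) ≤ 1 - x)
  rw [Real.one_rpow, hbpow, one_mul] at hH
  have hsum : x + (1 - x) = 1 := by ring
  rw [hsum, Real.one_rpow, mul_one] at hH
  -- bound (1 + b)^{1−κ} ≤ 59/25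
  have hb1 : b ≤ 32713 / 10000 := by
    have hexp : 1 / (1 - κ) ≤ (53 : ℝ) / 31 := by
      rw [div_le_div_iff₀ h1κ (by norm_num)]
      linarith
    exact (Real.rpow_le_rpow_of_exponent_le (by norm_num : (1:ℝ) ≤ 2) hexp).trans two_rpow_le
  have hbase : (1 + b) ^ (1 - κ) ≤ (42713 / 10000 : ℝ) ^ (1 - κ) :=
    Real.rpow_le_rpow (by linarith) (by linarith) h1κ.le
  have hexp2 : (42713 / 10000 : ℝ) ^ (1 - κ) ≤ (42713 / 10000 : ℝ) ^ ((24 : ℝ) / 41) :=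
    Real.rpow_le_rpow_of_exponent_le (by norm_num) (by linarith)
  linarith [rpow_24_41_le]

/-! ## 2. The two chords and the four linear conditions -/

/-- **Low chord** (`t = A/B ∈ [0, 1/2]`): if `0 ≤ A` and `2A ≤ B` then
`A x^{κ_S} + B (1−x)^{κ_S} ≤ B + (9/25) A`. -/
theorem chord_low {A B x : ℝ} (hA : 0 ≤ A) (h2A : 2 * A ≤ B) (hx0 : 0 ≤ x) (hx1 : x ≤ 1) :
    A * x ^ (Real.log (4 / 3) / Real.log 2) + B * (1 - x) ^ (Real.log (4 / 3) / Real.log 2) ≤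
      B + 9 / 25 * A := by
  set κ := Real.log (4 / 3) / Real.log 2
  have hT := one_two_bound hx0 hx1
  have hy1 : (1 - x) ^ κ ≤ 1 := Real.rpow_le_one (by linarith) (by linarith) kappaS_pos.le
  have e : A * x ^ κ + B * (1 - x) ^ κ = A * (x ^ κ + 2 * (1 - x) ^ κ) + (B - 2 * A) * (1 - x) ^ κ := by ring
  rw [e]
  nlinarith [mul_le_mul_of_nonneg_left hT hA, mul_le_mul_of_nonneg_left hy1 (by linarith : (0:ℝ) ≤ B - 2 * A)]

/-- **High chord** (`t = A/B ∈ [1/2, 1]`): if `A ≤ B ≤ 2A` then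
`A x^{κ_S} + B (1−x)^{κ_S} ≤ (16/25) A + (43/50) B`. -/
theorem chord_high {A B x : ℝ} (hAB : A ≤ B) (hB2 : B ≤ 2 * A) (hx0 : 0 ≤ x) (hx1 : x ≤ 1) :
    A * x ^ (Real.log (4 / 3) / Real.log 2) + B * (1 - x) ^ (Real.log (4 / 3) / Real.log 2) ≤
      16 / 25 * A + 43 / 50 * B := by
  set κ := Real.log (4 / 3) / Real.log 2
  have hT := one_two_bound hx0 hx1
  have hS := rpow_add_rpow_le_three_halves hx0 hx1
  have e : A * x ^ κ + B * (1 - x) ^ κ =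
      (B - A) * (x ^ κ + 2 * (1 - x) ^ κ) + (2 * A - B) * (x ^ κ + (1 - x) ^ κ) := by ring
  rw [e]
  nlinarith [mul_le_mul_of_nonneg_left hT (sub_nonneg.mpr hAB),
    mul_le_mul_of_nonneg_left hS (by linarith : (0:ℝ) ≤ 2 * A - B)]

/-- **Four linear conditions suffice.**  For `A, B ≥ 0`, `x ∈ [0,1]` and any `R` with
`B + (9/25)A ≤ R`, `(16/25)A + (43/50)B ≤ R`, `A + (9/25)B ≤ R`, `(16/25)B + (43/50)A ≤ R`:
`A x^{κ_S} + B (1−x)^{κ_S} ≤ R`. -/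
theorem pair_le_of_chords {A B R x : ℝ} (hA : 0 ≤ A) (hB : 0 ≤ B) (hx0 : 0 ≤ x) (hx1 : x ≤ 1)
    (h1 : B + 9 / 25 * A ≤ R) (h2 : 16 / 25 * A + 43 / 50 * B ≤ R)
    (h3 : A + 9 / 25 * B ≤ R) (h4 : 16 / 25 * B + 43 / 50 * A ≤ R) :
    A * x ^ (Real.log (4 / 3) / Real.log 2) + B * (1 - x) ^ (Real.log (4 / 3) / Real.log 2) ≤ R := by
  rcases le_total A B with hAB | hBA
  · rcases le_total (2 * A) B with h2A | hB2
    · exact (chord_low hA h2A hx0 hx1).trans h1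
    · exact (chord_high hAB hB2 hx0 hx1).trans h2
  · -- swap the roles of the two factors via x ↦ 1 − x
    have hy0 : 0 ≤ 1 - x := by linarith
    have hy1 : 1 - x ≤ 1 := by linarith
    have e : A * x ^ (Real.log (4 / 3) / Real.log 2) + B * (1 - x) ^ (Real.log (4 / 3) / Real.log 2) =
        B * (1 - x) ^ (Real.log (4 / 3) / Real.log 2) +
          A * (1 - (1 - x)) ^ (Real.log (4 / 3) / Real.log 2) := by
      rw [sub_sub_cancel]; ring
    rw [e]
    rcases le_total (2 * B) A with h2B | hA2
    · exact (chord_low hB h2B hy0 hy1).trans h3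
    · exact (chord_high hBA hA2 hy0 hy1).trans h4

/-! ## 3. The defect identity (every `β`) and the reduction to two polynomial conditions -/

/-- **Defect identity**, every dial: with `α = ε+1−V`, `α' = ε+1−V'`, `w = 1 − z(1+ε)`,
`A + B − (λ_P(1+ε) − num) = λλ'(z α α' + w(α + α' − 1 − ε))` — the `β`-dependence cancels. -/
theorem defect_identity_gen (β z ε l l' V V' : ℝ) :
    (1 - (β - 1) * l') * (l * (ε + 1 - V)) + (1 - (β - 1) * l) * (l' * (ε + 1 - V')) -
        ((l + l' - (2 * β - 1) * l * l') * (ε + 1) -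
          (l' * (1 - β * l) * V' + l * (1 - β * l') * V + z * l * l' * V * V')) =
      l * l' * (z * (ε + 1 - V) * (ε + 1 - V') +
        (1 - z * (1 + ε)) * ((ε + 1 - V) + (ε + 1 - V') - 1 - ε)) := by
  ring

/-- **THE CHORD SPLIT.**  At any dial: if on the pinned region (the hypotheses of `RegionCriterion`)
the defect `D = λλ'(z α α' + w(α + α' − 1 − ε))` satisfies the two polynomial conditions
(I) `D ≤ (16/25)A`, `D ≤ (16/25)B` and (II) `D ≤ (9/25)A + (7/50)B`, `D ≤ (9/25)B + (7/50)A`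
(`A = (1−(β−1)λ')λ(ε+1−V)`, `B` symmetric), then `RegionCriterion β z ε Vmin κ_S`. -/
theorem regionCriterion_of_chordConditions {β z ε Vmin : ℝ} (hβ : 1 ≤ β) (hε : 0 ≤ ε)
    (h : ∀ lam lam' V V' VP : ℝ,
      0 < lam → β * lam ≤ 1 → 0 < lam' → β * lam' ≤ 1 →
      Vmin ≤ V → V ≤ 1 → Vmin ≤ V' → V' ≤ 1 →
      β * ((2 * β - 1) * lam - 1) ≤ (β - 1) * V → β * ((2 * β - 1) * lam' - 1) ≤ (β - 1) * V' →
      |1 - (2 * β - 1) * lam| ≤ V ^ 2 → |1 - (2 * β - 1) * lam'| ≤ V' ^ 2 →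
      VP * (lam + lam' - (2 * β - 1) * lam * lam') =
        lam' * (1 - β * lam) * V' + lam * (1 - β * lam') * V + z * lam * lam' * V * V' →
      Vmin ≤ VP →
      lam * lam' * (z * (ε + 1 - V) * (ε + 1 - V') +
          (1 - z * (1 + ε)) * ((ε + 1 - V) + (ε + 1 - V') - 1 - ε)) ≤
        16 / 25 * ((1 - (β - 1) * lam') * (lam * (ε + 1 - V))) ∧
      lam * lam' * (z * (ε + 1 - V) * (ε + 1 - V') +
          (1 - z * (1 + ε)) * ((ε + 1 - V) + (ε + 1 - V') - 1 - ε)) ≤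
        16 / 25 * ((1 - (β - 1) * lam) * (lam' * (ε + 1 - V'))) ∧
      lam * lam' * (z * (ε + 1 - V) * (ε + 1 - V') +
          (1 - z * (1 + ε)) * ((ε + 1 - V) + (ε + 1 - V') - 1 - ε)) ≤
        9 / 25 * ((1 - (β - 1) * lam') * (lam * (ε + 1 - V))) +
          7 / 50 * ((1 - (β - 1) * lam) * (lam' * (ε + 1 - V'))) ∧
      lam * lam' * (z * (ε + 1 - V) * (ε + 1 - V') +
          (1 - z * (1 + ε)) * ((ε + 1 - V) + (ε + 1 - V') - 1 - ε)) ≤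
        9 / 25 * ((1 - (β - 1) * lam) * (lam' * (ε + 1 - V'))) +
          7 / 50 * ((1 - (β - 1) * lam') * (lam * (ε + 1 - V)))) :
    RegionCriterion β z ε Vmin (Real.log (4 / 3) / Real.log 2) := by
  intro l l' V V' VP hl hl1 hl' hl'1 hV0 hV1 hV'0 hV'1 hwl hwl' hp hp' hP hVP x hx0 hx1
  obtain ⟨hI, hI', hII, hII'⟩ := h l l' V V' VP hl hl1 hl' hl'1 hV0 hV1 hV'0 hV'1 hwl hwl' hp hp' hP hVP
  have hl1' : l ≤ 1 := by nlinarith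
  have hl'1' : l' ≤ 1 := by nlinarith
  have hA : 0 ≤ (1 - (β - 1) * l') * (l * (ε + 1 - V)) :=
    mul_nonneg (by nlinarith) (mul_nonneg hl.le (by linarith))
  have hB : 0 ≤ (1 - (β - 1) * l) * (l' * (ε + 1 - V')) :=
    mul_nonneg (by nlinarith) (mul_nonneg hl'.le (by linarith))
  -- R = A + B − D
  have hR : (l + l' - (2 * β - 1) * l * l') * (ε + 1 - VP) =
      (1 - (β - 1) * l') * (l * (ε + 1 - V)) + (1 - (β - 1) * l) * (l' * (ε + 1 - V')) -
        l * l' * (z * (ε + 1 - V) * (ε + 1 - V') +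
          (1 - z * (1 + ε)) * ((ε + 1 - V) + (ε + 1 - V') - 1 - ε)) := by
    have e : (l + l' - (2 * β - 1) * l * l') * (ε + 1 - VP) =
        (l + l' - (2 * β - 1) * l * l') * (ε + 1) - VP * (l + l' - (2 * β - 1) * l * l') := by ring
    rw [e, hP]
    linarith [defect_identity_gen β z ε l l' V V']
  rw [hR]
  exact pair_le_of_chords hA hB hx0 hx1 (by linarith) (by linarith) (by linarith) (by linarith)

/-! ## 4. Consistency: the chord conditions at the endpoint `β = 2` -/

/-- At `β = 2`, floor `0`, the branch inequality `2D ≤ min(A,B)` of kernel XLVI gives the chord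
conditions (I) and (II) on the pinned region; with `regionCriterion_of_chordConditions` this is a second
proof of XLVI's `regionCriterion_two_floorZero`. -/
theorem chordConditions_two_floorZero {z ε : ℝ} (hz : 3 / 4 ≤ z) (hε0 : 0 ≤ ε) (hε1 : ε ≤ 1 / 3)
    (hw : z * (1 + ε) ≤ 1) {l l' V V' : ℝ} (hl : 0 < l) (hl1 : 2 * l ≤ 1) (hl' : 0 < l')
    (hl'1 : 2 * l' ≤ 1) (hV0 : 0 ≤ V) (hV1 : V ≤ 1) (hV'0 : 0 ≤ V') (hV'1 : V' ≤ 1)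
    (hwl : 2 * ((2 * 2 - 1) * l - 1) ≤ (2 - 1) * V) (hwl' : 2 * ((2 * 2 - 1) * l' - 1) ≤ (2 - 1) * V') :
    l * l' * (z * (ε + 1 - V) * (ε + 1 - V') +
        (1 - z * (1 + ε)) * ((ε + 1 - V) + (ε + 1 - V') - 1 - ε)) ≤
      16 / 25 * ((1 - (2 - 1) * l') * (l * (ε + 1 - V))) ∧
    l * l' * (z * (ε + 1 - V) * (ε + 1 - V') +
        (1 - z * (1 + ε)) * ((ε + 1 - V) + (ε + 1 - V') - 1 - ε)) ≤
      16 / 25 * ((1 - (2 - 1) * l) * (l' * (ε + 1 - V'))) ∧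
    l * l' * (z * (ε + 1 - V) * (ε + 1 - V') +
        (1 - z * (1 + ε)) * ((ε + 1 - V) + (ε + 1 - V') - 1 - ε)) ≤
      9 / 25 * ((1 - (2 - 1) * l') * (l * (ε + 1 - V))) +
        7 / 50 * ((1 - (2 - 1) * l) * (l' * (ε + 1 - V'))) ∧
    l * l' * (z * (ε + 1 - V) * (ε + 1 - V') +
        (1 - z * (1 + ε)) * ((ε + 1 - V) + (ε + 1 - V') - 1 - ε)) ≤
      9 / 25 * ((1 - (2 - 1) * l) * (l' * (ε + 1 - V'))) +
        7 / 50 * ((1 - (2 - 1) * l') * (l * (ε + 1 - V))) := by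
  have hA : 0 ≤ (1 - (2 - 1) * l') * (l * (ε + 1 - V)) :=
    mul_nonneg (by linarith) (mul_nonneg hl.le (by linarith))
  have hB : 0 ≤ (1 - (2 - 1) * l) * (l' * (ε + 1 - V')) :=
    mul_nonneg (by linarith) (mul_nonneg hl'.le (by linarith))
  have hDA := mul_le_mul_of_nonneg_left
    (branch_ineq (V := V) (V' := V') hz hε0 hε1 hw hl'.le hl'1 hV0 hV1 hV'0 hwl') hl.le
  have hDB := mul_le_mul_of_nonneg_left
    (branch_ineq (V := V') (V' := V) hz hε0 hε1 hw hl.le hl1 hV'0 hV'1 hV0 hwl) hl'.le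
  have e1 : l * (2 * (l' * (z * (ε + 1 - V) * (ε + 1 - V') +
      (1 - z * (1 + ε)) * ((ε + 1 - V) + (ε + 1 - V') - 1 - ε)))) =
      2 * (l * l' * (z * (ε + 1 - V) * (ε + 1 - V') +
        (1 - z * (1 + ε)) * ((ε + 1 - V) + (ε + 1 - V') - 1 - ε))) := by ring
  have e2 : l' * (2 * (l * (z * (ε + 1 - V') * (ε + 1 - V) +
      (1 - z * (1 + ε)) * ((ε + 1 - V') + (ε + 1 - V) - 1 - ε)))) =
      2 * (l * l' * (z * (ε + 1 - V) * (ε + 1 - V') +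
        (1 - z * (1 + ε)) * ((ε + 1 - V) + (ε + 1 - V') - 1 - ε))) := by ring
  have e3 : l * ((1 - (2 - 1) * l') * (ε + 1 - V)) = (1 - (2 - 1) * l') * (l * (ε + 1 - V)) := by ring
  have e4 : l' * ((1 - (2 - 1) * l) * (ε + 1 - V')) = (1 - (2 - 1) * l) * (l' * (ε + 1 - V')) := by ring
  rw [e1, e3] at hDA
  rw [e2, e4] at hDB
  refine ⟨by linarith, by linarith, by linarith, by linarith⟩

/-! ## 5. The open corner, reduced to the polynomial conditions -/

/-- **The corner `(199/100, 2)` ⟸ (I) ∧ (II) for a regulariser family.**  If for every `β` of the corner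
some `z ∈ [9/10, 1]`, `ε ∈ (0, …)` and depth `m` make the chord conditions hold on the pinned region with
the exact floor `Vmin = Vfloor 2 β z m`, then XL-D(a, β) holds for every `a ≥ 2` on the corner.  The
hypothesis is polynomial in the region data (no exponentials); memo NODE-g63 §3 records its numerical
margins for `z = 1 − (2/3)(2−β)`, `ε = 1 − z`, `m = ⌈log₂(1/(2−β))⌉ + 4`. -/
theorem capXLD_corner_of_chordConditions
    (h : ∀ β : ℝ, 199 / 100 ≤ β → β < 2 → ∃ z ε : ℝ, ∃ m : ℕ, 9 / 10 ≤ z ∧ z ≤ 1 ∧ 0 < ε ∧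
      ∀ lam lam' V V' VP : ℝ,
        0 < lam → β * lam ≤ 1 → 0 < lam' → β * lam' ≤ 1 →
        Vfloor 2 β z m ≤ V → V ≤ 1 → Vfloor 2 β z m ≤ V' → V' ≤ 1 →
        β * ((2 * β - 1) * lam - 1) ≤ (β - 1) * V → β * ((2 * β - 1) * lam' - 1) ≤ (β - 1) * V' →
        |1 - (2 * β - 1) * lam| ≤ V ^ 2 → |1 - (2 * β - 1) * lam'| ≤ V' ^ 2 →
        VP * (lam + lam' - (2 * β - 1) * lam * lam') =
          lam' * (1 - β * lam) * V' + lam * (1 - β * lam') * V + z * lam * lam' * V * V' →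
        Vfloor 2 β z m ≤ VP →
        lam * lam' * (z * (ε + 1 - V) * (ε + 1 - V') +
            (1 - z * (1 + ε)) * ((ε + 1 - V) + (ε + 1 - V') - 1 - ε)) ≤
          16 / 25 * ((1 - (β - 1) * lam') * (lam * (ε + 1 - V))) ∧
        lam * lam' * (z * (ε + 1 - V) * (ε + 1 - V') +
            (1 - z * (1 + ε)) * ((ε + 1 - V) + (ε + 1 - V') - 1 - ε)) ≤
          16 / 25 * ((1 - (β - 1) * lam) * (lam' * (ε + 1 - V'))) ∧
        lam * lam' * (z * (ε + 1 - V) * (ε + 1 - V') +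
            (1 - z * (1 + ε)) * ((ε + 1 - V) + (ε + 1 - V') - 1 - ε)) ≤
          9 / 25 * ((1 - (β - 1) * lam') * (lam * (ε + 1 - V))) +
            7 / 50 * ((1 - (β - 1) * lam) * (lam' * (ε + 1 - V'))) ∧
        lam * lam' * (z * (ε + 1 - V) * (ε + 1 - V') +
            (1 - z * (1 + ε)) * ((ε + 1 - V) + (ε + 1 - V') - 1 - ε)) ≤
          9 / 25 * ((1 - (β - 1) * lam) * (lam' * (ε + 1 - V'))) +
            7 / 50 * ((1 - (β - 1) * lam') * (lam * (ε + 1 - V)))) :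
    ∀ a β : ℝ, 2 ≤ a → 199 / 100 ≤ β → β < 2 →
      ∀ R : ℝ, 0 ≤ R → ∀ y₀ : ℝ → ℝ, (∀ b : ℝ, 0 ≤ b → 0 ≤ y₀ b ∧ y₀ b ≤ R / (b + β)) →
        ∃ C : ℝ, ∀ s : Sched, Admissible a β s →
          dev β y₀ s ≤ C * logSize β s ^ (Real.log (4 / 3) / Real.log 2) := by
  intro a β ha h0 h1
  obtain ⟨z, ε, m, hz, hz1, hε, hcond⟩ := h β h0 h1
  exact capXLD_allA_of_criterion m ha (by linarith) h1.le hz hz1 hε le_rfl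
    (regionCriterion_of_chordConditions (by linarith) hε.le hcond)

end Summit.MatrixMultiplication.MatrixMultiplication.Theorems.FarEdgeDescentChordSplit

end
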